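import Mathlib
import HarnessLib
import Summits.Ventures.LatticeQCDFlow.Scoring.SU3RealTraceFixedVector

/-!
# `det(1 + U) = 2 + 2 Re tr U` on `SU(3)`: the eigenvalue `−1` occurs exactly on the line `Re tr U = −1`

HONEST FRAMING: exact (Metropolis-corrected) sampling algorithms for lattice gauge theory;
figures of merit are autocorrelation/cost numbers at stated couplings and volumes; no
continuum-physics claim.

Venture `LatticeQCDFlow` (cell pub-lqcd), sub-topic `Scoring`; FANOUT row 21 (`su3-base`: the 4D
`SU(3)` baselines).  NEW WORK of the cell (placement rule), elementary, companion of row 21 GEN-8's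
`Scoring/SU3RealTraceFixedVector` (`det(1 − U) = conj(tr U) − tr U`: a FIXED vector, eigenvalue
`+1`, iff `Im tr U = 0`).  No definition is introduced; nothing is cited as a fact; no number of
ours.

Here the eigenvalue `−1`.  For a `3 × 3` matrix `det(1 + M) = 1 + tr M + tr adj M + det M` (the
characteristic polynomial at `−1`, up to sign); on `SU(3)` `adj U = U†` and `det U = 1`, so

  `det(1 + U) = 2 + tr U + conj(tr U) = 2 (1 + Re tr U)`,

a REAL number, and `U` has an eigenvector with eigenvalue `−1` iff `Re tr U = −1` — in plaquette
units `P = Re tr U / 3 = −1/3`.  In the trace picture this is the vertical line `Re t = −1`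
through the deltoid, which contains the real point `t = −1` (the non-trivial involutions) and the
spoke points `−1 ± i√3 = 2ζ^{±1}` (no claim is made here about which other points of that line are
traces).

## What is proved

* `det_one_add_fin_three_su3` — `det(1 + U) = 2 + tr U + conj(tr U)` on `SU(3)`;
* **`su3_det_one_add_eq_re`** — `det(1 + U) = 2 + 2 Re tr U` (a real number);
  `su3_norm_det_one_add` — `‖det(1 + U)‖ = 2 |1 + Re tr U|`;
* **`su3_det_one_add_eq_zero_iff`** — `det(1 + U) = 0 ⇔ Re tr U = −1`;
* **`su3_exists_eigenvector_neg_one_iff`** — `(∃ v ≠ 0, U v = −v) ⇔ Re tr U = −1`.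

NOT CLAIMED: anything for `N ≠ 3`; a description of the set of traces with `Re t = −1`.
-/

namespace Summit.Ventures.LatticeQCDFlow.Scoring

open Matrix

section SpecialUnitaryThree

/-- **`det(1 + U) = 2 + tr U + conj(tr U)`** for `U ∈ SU(3)` (`det(1 + M) = 1 + tr M + tr adj M +
det M` for `3 × 3` matrices; `adj U = U†`, `det U = 1`). -/
theorem det_one_add_fin_three_su3 (U : Matrix.specialUnitaryGroup (Fin 3) ℂ) :
    (1 + (U : Matrix (Fin 3) (Fin 3) ℂ)).det =
      2 + (U : Matrix (Fin 3) (Fin 3) ℂ).trace + (starRingEnd ℂ) (U : Matrix (Fin 3) (Fin 3) ℂ).trace := by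
  have hU := U.2
  have hunit : (U : Matrix (Fin 3) (Fin 3) ℂ) ∈ Matrix.unitaryGroup (Fin 3) ℂ :=
    (Matrix.mem_specialUnitaryGroup_iff.mp hU).1
  have hdet : (U : Matrix (Fin 3) (Fin 3) ℂ).det = 1 := (Matrix.mem_specialUnitaryGroup_iff.mp hU).2
  -- `det(1 + M) = 1 + tr M + tr adj M + det M` for any `3 × 3` matrix
  have hgen : ∀ M : Matrix (Fin 3) (Fin 3) ℂ,
      (1 + M).det = 1 + M.trace + (adjugate M).trace + M.det := by
    intro M
    have hadj : (adjugate M).trace = M 1 1 * M 2 2 - M 1 2 * M 2 1 + (M 0 0 * M 2 2 - M 0 2 * M 2 0)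
        + (M 0 0 * M 1 1 - M 0 1 * M 1 0) := by
      simp [adjugate_fin_three, trace_fin_three]
    rw [hadj, det_fin_three, det_fin_three, trace_fin_three]
    simp
    ring
  -- `adj U = U†`, so `tr adj U = conj tr U`
  have hadj : adjugate (U : Matrix (Fin 3) (Fin 3) ℂ) = star (U : Matrix (Fin 3) (Fin 3) ℂ) := by
    have h1 : (U : Matrix (Fin 3) (Fin 3) ℂ) * adjugate (U : Matrix (Fin 3) (Fin 3) ℂ) = 1 := by
      rw [mul_adjugate, hdet, one_smul]
    have h2 : star (U : Matrix (Fin 3) (Fin 3) ℂ) * (U : Matrix (Fin 3) (Fin 3) ℂ) = 1 :=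
      Unitary.star_mul_self_of_mem hunit
    calc adjugate (U : Matrix (Fin 3) (Fin 3) ℂ)
        = (star (U : Matrix (Fin 3) (Fin 3) ℂ) * (U : Matrix (Fin 3) (Fin 3) ℂ)) *
            adjugate (U : Matrix (Fin 3) (Fin 3) ℂ) := by rw [h2, Matrix.one_mul]
      _ = star (U : Matrix (Fin 3) (Fin 3) ℂ) *
            ((U : Matrix (Fin 3) (Fin 3) ℂ) * adjugate (U : Matrix (Fin 3) (Fin 3) ℂ)) := by
          rw [Matrix.mul_assoc]
      _ = star (U : Matrix (Fin 3) (Fin 3) ℂ) := by rw [h1, Matrix.mul_one]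
  have htr : (adjugate (U : Matrix (Fin 3) (Fin 3) ℂ)).trace =
      (starRingEnd ℂ) (U : Matrix (Fin 3) (Fin 3) ℂ).trace := by
    rw [hadj, star_eq_conjTranspose, trace_conjTranspose, Complex.star_def]
  rw [hgen, htr, hdet]
  ring

/-- **`det(1 + U) = 2 + 2 Re tr U`** on `SU(3)` — a real number (`= 2 (1 + 3P)` in plaquette units
`P = Re tr U / 3`). -/
theorem su3_det_one_add_eq_re (U : Matrix.specialUnitaryGroup (Fin 3) ℂ) :
    (1 + (U : Matrix (Fin 3) (Fin 3) ℂ)).det =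
      ((2 + 2 * ((U : Matrix (Fin 3) (Fin 3) ℂ).trace).re : ℝ) : ℂ) := by
  rw [det_one_add_fin_three_su3, add_assoc, Complex.add_conj]
  push_cast
  ring

/-- `‖det(1 + U)‖ = 2 |1 + Re tr U|` on `SU(3)`. -/
theorem su3_norm_det_one_add (U : Matrix.specialUnitaryGroup (Fin 3) ℂ) :
    ‖(1 + (U : Matrix (Fin 3) (Fin 3) ℂ)).det‖ = 2 * |1 + ((U : Matrix (Fin 3) (Fin 3) ℂ).trace).re| := by
  rw [su3_det_one_add_eq_re, Complex.norm_real, Real.norm_eq_abs,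
    show (2 : ℝ) + 2 * ((U : Matrix (Fin 3) (Fin 3) ℂ).trace).re
      = 2 * (1 + ((U : Matrix (Fin 3) (Fin 3) ℂ).trace).re) by ring,
    abs_mul, abs_of_pos (by norm_num : (0 : ℝ) < 2)]

/-- **`det(1 + U) = 0 ⇔ Re tr U = −1`** on `SU(3)`. -/
theorem su3_det_one_add_eq_zero_iff (U : Matrix.specialUnitaryGroup (Fin 3) ℂ) :
    (1 + (U : Matrix (Fin 3) (Fin 3) ℂ)).det = 0 ↔ ((U : Matrix (Fin 3) (Fin 3) ℂ).trace).re = -1 := by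
  rw [su3_det_one_add_eq_re, Complex.ofReal_eq_zero]
  constructor
  · intro h; linarith
  · intro h; rw [h]; norm_num

/-- **`−1` is an eigenvalue of `U ∈ SU(3)` iff `Re tr U = −1`**: there is a non-zero `v` with
`U v = −v` exactly on the line `Re t = −1` of the trace plane (plaquette `P = −1/3`). -/
theorem su3_exists_eigenvector_neg_one_iff (U : Matrix.specialUnitaryGroup (Fin 3) ℂ) :
    (∃ v : Fin 3 → ℂ, v ≠ 0 ∧ (U : Matrix (Fin 3) (Fin 3) ℂ) *ᵥ v = -v) ↔
      ((U : Matrix (Fin 3) (Fin 3) ℂ).trace).re = -1 := by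
  rw [← su3_det_one_add_eq_zero_iff, ← Matrix.exists_mulVec_eq_zero_iff]
  constructor
  · rintro ⟨v, hv, h⟩
    exact ⟨v, hv, by rw [add_mulVec, one_mulVec, h, add_neg_cancel]⟩
  · rintro ⟨v, hv, h⟩
    refine ⟨v, hv, ?_⟩
    rw [add_mulVec, one_mulVec] at h
    exact eq_neg_of_add_eq_zero_right h

/-- In particular the non-trivial real-trace minimisers (`tr U = −1`, cf. `SU3TraceDeltoid`'s
`Re tr U ≥ −1` for real traces) have an eigenvector with eigenvalue `−1`. -/
theorem su3_exists_eigenvector_neg_one_of_trace_eq_neg_one (U : Matrix.specialUnitaryGroup (Fin 3) ℂ)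
    (h : (U : Matrix (Fin 3) (Fin 3) ℂ).trace = -1) :
    ∃ v : Fin 3 → ℂ, v ≠ 0 ∧ (U : Matrix (Fin 3) (Fin 3) ℂ) *ᵥ v = -v := by
  rw [su3_exists_eigenvector_neg_one_iff, h]
  norm_num

end SpecialUnitaryThree

end Summit.Ventures.LatticeQCDFlow.Scoring
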